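import Literature.Analysis.FluidPDE.PeriodicCylinderDifferenceQuotients
import HarnessLib

/-!
# Tangential weak derivatives of the weak periodic Neumann solution on the cylinder

Topic `Literature/Analysis/FluidPDE`. Theorem-only file (no definitions, no named facts): the
**tangential regularity step** of the regularity theory for the weak periodic Neumann problem on
the cylinder `{r ≤ 1} × ℝ/Lℤ` (`PeriodicCylinderHelmholtz`, `…Symmetry`, `…NeumannCovariance`,
`…DifferenceQuotients`), the analytic input of the local existence theorem for the Euler
equations in the periodic cylinder (T. Kato, C. Y. Lai, J. Funct. Anal. **56** (1984), Thm I/II;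
the tree's named fact `Literature.Analysis.FluidPDE.KatoLai1984_periodicCylinderUniformExistence`).
It is Nirenberg's argument (CPAM 8 (1955), Kato–Lai's [11] for their (5.5)) in its simplest
instance — the data are smooth, so the difference quotients of the solution converge **strongly**:

For smooth `L`-periodic data `h₀` (scalar) and `h₁` (field) on the closed cylinder, let
`∇q = ∇q[h₀, h₁] ∈ 𝓖` be the weak solution (`neumannGrad`) of `Δq = div h₁ − h₀`, `∂q/∂n = h₁·n`,
periodic.

* `axialQuot_coe_neumannGrad`, `rotQuot_coe_neumannGrad` — **the difference quotients of the
  solution along the symmetries are the solutions for the difference quotients of the data**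
  (covariance of the problem, `coe_neumannGrad_axialShiftLp/rotFieldLp`, and linearity,
  `neumannGrad_add/smul/sub`);
* `tendsto_toCell_axialQuot`, `tendsto_toCell_rotQuot`, `tendsto_toCell_rotFieldQuot` — the
  difference quotients of smooth periodic data converge in `L²(cell)` to `∂_z h`, `∂_J h = Dh(Jx)`,
  resp. `∂_J h₁ − J h₁` (the generator of `h₁ ↦ R_{−θ} h₁ ∘ R_θ`): pointwise by differentiability,
  dominated by the periodic sup bounds of `Dh` (`exists_forall_norm_fderivWithin_le`: a continuous
  periodic function is bounded on the closed cylinder, `exists_forall_norm_le_of_periodic`, by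
  reduction to the compact block `{r ≤ 1, 0 ≤ z ≤ L}`) and the mean value inequality within the
  convex closed cylinder along the flow lines; `tendsto_toCell_of_dominated` turns this into `L²`
  convergence;
* `tendsto_neumannGrad` — the solution map is continuous in the data (`‖∇q‖ ≤ C_P‖h₀‖ + ‖h₁‖`);
* hence (`hasWeakDerivAlong_eZ_neumannGrad`) **`∇q[h₀,h₁]` has along `e_z` the weak derivative
  `∇q[∂_z h₀, ∂_z h₁]` on the open cell**, and (`tendsto_rotQuot_coe_neumannGrad`) its rotational
  quotients converge to `∇q[∂_J h₀, ∂_J h₁ − J h₁]`; for the frame components this gives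
  (`hasWeakDerivAlong_rotGen_inner_neumannGrad`, `hasWeakDerivAlong_eZ_inner_neumannGrad`): for every
  smooth rotation-equivariant field `V` bounded on the cell (`x_h`, `Jx`, `e_z`), **`⟪V, ∇q[h₀,h₁]⟫`
  has the weak derivative `⟪V, ∇q[∂_J h₀, ∂_J h₁ − J h₁]⟫` along `J`** (the rotation of the pairing
  is the pairing with the rotated field, `rotLp_toCell_inner_equivariant`, so the scalar
  difference-quotient lemma `hasWeakDerivAlong_rotGen_of_tendsto` applies), and for `z`-independent
  `V` the weak derivative `⟪V, ∇q[∂_z h₀, ∂_z h₁]⟫` along `e_z`;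
* `neumannGrad_axialData_eq`, `neumannGrad_rotData_eq` — the **economical form of the differentiated
  data**, `∇q[∂_z h₀, ∂_z h₁] = ∇q[0, ∂_z h₁ − h₀ e_z]` and `∇q[∂_J h₀, ∂_J h₁ − Jh₁] = ∇q[0, ∂_J h₁ − Jh₁ − h₀ J]`
  (periodic integration by parts on the cell, `setIntegral_cylDeriv_cylBasis_two_mul`,
  `setIntegral_cylDeriv_rotGen_mul`), which at the top order of a regularity count costs no
  derivative of `h₀`.

Since the differentiated data are again smooth periodic, the theorems iterate to all tangential
words; the radial direction (from the interior equation) and the interior are the sequel files.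

Mathlib/tree search: everything is assembled from the four preceding files of this line, the tree's
within-calculus on the closed cylinder (`cylDeriv`, `cylGrad`, `contDiffOn_cylDeriv`,
`IsAxiallyPeriodic.cylDeriv`, `IsAxiallyPeriodic.fderivWithin_closure`, `cylDeriv_eq_fderiv`,
`closure_unitCylinder_mem_nhds`, `uniqueDiffOn_K`, `rotGen_add_axialShift`, `rotGenL`,
`hasDerivAt_rotZ(_zero)`), and Mathlib's `Convex.norm_image_sub_le_of_norm_fderivWithin_le`,
`Convex.norm_image_sub_le_of_norm_deriv_le`, `HasDerivAt.tendsto_slope_zero`,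
`tendsto_integral_of_dominated_convergence`, `MemLp.of_bound`, `MemLp.of_le_mul`,
`eLpNorm_le_mul_eLpNorm_of_ae_le_mul`, `integral_norm_sq_eq_toReal_eLpNorm_two_sq` (tree).
No tangential-regularity statement for a weak Neumann problem existed in the tree (the tree's
`PeriodicCylinderNeumannTangential.lean` is the a-priori estimate for *smooth* solutions).

## References

* L. Nirenberg, Comm. Pure Appl. Math. 8 (1955) 649–675 (difference quotients along symmetries).
  [folklore]
* L. C. Evans, *Partial Differential Equations*, 2nd ed. (2010), §5.8.2, §6.3.1 (difference
  quotients; regularity of weak solutions). [Evans2010]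
* T. Kato, C. Y. Lai, J. Funct. Anal. 56 (1984) 15–28, §4 (i), §5 and (5.5). [KatoLai1984]
-/

noncomputable section

open MeasureTheory Set Function Filter Topology TopologicalSpace WithLp Metric
open scoped ContDiff NNReal ENNReal InnerProductSpace RealInnerProductSpace

namespace Literature.Analysis.FluidPDE

open Literature.Analysis.FunctionSpaces

/-- Local notation for physical space `ℝ³ = EuclideanSpace ℝ (Fin 3)`. -/
local notation "ℝ³" => EuclideanSpace ℝ (Fin 3)

/-- Local notation for the closed unit cylinder `{r ≤ 1}`. -/
local notation "𝕂" => closure (SetLike.coe unitCylinder : Set (EuclideanSpace ℝ (Fin 3)))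

namespace PeriodicCylinder

variable {L : ℝ}

/-! ### Linearity and continuity of the weak Neumann solution in the data -/

/-- The data functional is additive in the data. [folklore] -/
theorem neumannFunctional_add (h₀ h₀' : Lp ℝ 2 (cellMeasure L)) (h₁ h₁' : Lp ℝ³ 2 (cellMeasure L)) :
    neumannFunctional L (h₀ + h₀') (h₁ + h₁') = neumannFunctional L h₀ h₁ + neumannFunctional L h₀' h₁' := by
  ext Ψ
  simp only [neumannFunctional_apply, _root_.FunLike.coe_add, Pi.add_apply, inner_add_left]
  ring

/-- The data functional is homogeneous in the data. [folklore] -/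
theorem neumannFunctional_smul (c : ℝ) (h₀ : Lp ℝ 2 (cellMeasure L)) (h₁ : Lp ℝ³ 2 (cellMeasure L)) :
    neumannFunctional L (c • h₀) (c • h₁) = c • neumannFunctional L h₀ h₁ := by
  ext Ψ
  simp only [neumannFunctional_apply, _root_.FunLike.coe_smul, Pi.smul_apply, inner_smul_left,
    smul_eq_mul, RCLike.conj_to_real]
  ring

/-- **The weak Neumann solution is additive in the data.** [folklore] -/
theorem neumannGrad_add (h₀ h₀' : Lp ℝ 2 (cellMeasure L)) (h₁ h₁' : Lp ℝ³ 2 (cellMeasure L)) :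
    neumannGrad L (h₀ + h₀') (h₁ + h₁') = neumannGrad L h₀ h₁ + neumannGrad L h₀' h₁' := by
  simp only [neumannGrad, neumannFunctional_add, map_add]

/-- **The weak Neumann solution is homogeneous in the data.** [folklore] -/
theorem neumannGrad_smul (c : ℝ) (h₀ : Lp ℝ 2 (cellMeasure L)) (h₁ : Lp ℝ³ 2 (cellMeasure L)) :
    neumannGrad L (c • h₀) (c • h₁) = c • neumannGrad L h₀ h₁ := by
  simp only [neumannGrad, neumannFunctional_smul, LinearIsometryEquiv.map_smulₛₗ, starRingEnd_apply,
    star_trivial]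

/-- The weak Neumann solution of the difference of data. [folklore] -/
theorem neumannGrad_sub (h₀ h₀' : Lp ℝ 2 (cellMeasure L)) (h₁ h₁' : Lp ℝ³ 2 (cellMeasure L)) :
    neumannGrad L (h₀ - h₀') (h₁ - h₁') = neumannGrad L h₀ h₁ - neumannGrad L h₀' h₁' := by
  rw [sub_eq_add_neg, sub_eq_add_neg, ← neg_one_smul ℝ h₀', ← neg_one_smul ℝ h₁', neumannGrad_add,
    neumannGrad_smul, neg_one_smul, sub_eq_add_neg]

/-- **Continuity of the weak Neumann solution in the data**: `L²`-convergent data give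
`L²`-convergent solutions (`‖∇q‖ ≤ C_P ‖h₀‖ + ‖h₁‖`). [folklore] -/
theorem tendsto_neumannGrad {ι : Type*} {l : Filter ι} {h₀ : ι → Lp ℝ 2 (cellMeasure L)}
    {h₁ : ι → Lp ℝ³ 2 (cellMeasure L)} {g₀ : Lp ℝ 2 (cellMeasure L)} {g₁ : Lp ℝ³ 2 (cellMeasure L)}
    (hh₀ : Tendsto h₀ l (𝓝 g₀)) (hh₁ : Tendsto h₁ l (𝓝 g₁)) :
    Tendsto (fun i => neumannGrad L (h₀ i) (h₁ i)) l (𝓝 (neumannGrad L g₀ g₁)) := by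
  rw [tendsto_iff_norm_sub_tendsto_zero]
  have hb : ∀ i, ‖neumannGrad L (h₀ i) (h₁ i) - neumannGrad L g₀ g₁‖ ≤
      cellPoincareConst L * ‖h₀ i - g₀‖ + ‖h₁ i - g₁‖ := fun i => by
    rw [← neumannGrad_sub]
    exact norm_neumannGrad_le _ _
  have h0 : Tendsto (fun i => cellPoincareConst L * ‖h₀ i - g₀‖ + ‖h₁ i - g₁‖) l (𝓝 0) := by
    have t0 := (tendsto_iff_norm_sub_tendsto_zero.1 hh₀).const_mul (cellPoincareConst L)
    have t1 := tendsto_iff_norm_sub_tendsto_zero.1 hh₁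
    simpa using t0.add t1
  exact squeeze_zero (fun i => norm_nonneg _) hb h0

/-- The same for the underlying `L²` classes. [folklore] -/
theorem tendsto_coe_neumannGrad {ι : Type*} {l : Filter ι} {h₀ : ι → Lp ℝ 2 (cellMeasure L)}
    {h₁ : ι → Lp ℝ³ 2 (cellMeasure L)} {g₀ : Lp ℝ 2 (cellMeasure L)} {g₁ : Lp ℝ³ 2 (cellMeasure L)}
    (hh₀ : Tendsto h₀ l (𝓝 g₀)) (hh₁ : Tendsto h₁ l (𝓝 g₁)) :
    Tendsto (fun i => ((neumannGrad L (h₀ i) (h₁ i) : gradSpace L) : Lp ℝ³ 2 (cellMeasure L))) l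
      (𝓝 ((neumannGrad L g₀ g₁ : gradSpace L) : Lp ℝ³ 2 (cellMeasure L))) :=
  (continuous_subtype_val.tendsto _).comp (tendsto_neumannGrad hh₀ hh₁)

/-! ### Continuous periodic functions on the closed cylinder are bounded -/

/-- The closed fundamental block `{r ≤ 1, 0 ≤ z ≤ L}` is compact. [folklore] -/
theorem isCompact_closedBlock (L : ℝ) : IsCompact {x : ℝ³ | cylRadius x ≤ 1 ∧ x 2 ∈ Icc 0 L} := by
  refine Metric.isCompact_of_isClosed_isBounded ?_ ?_
  · exact (isClosed_le continuous_cylRadius continuous_const).inter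
      (isClosed_Icc.preimage (EuclideanSpace.proj (2 : Fin 3)).continuous)
  · refine (Metric.isBounded_closedBall (x := (0 : ℝ³)) (r := 1 + |L|)).subset fun x hx => ?_
    rw [Metric.mem_closedBall, dist_zero_right, EuclideanSpace.norm_eq, Fin.sum_univ_three]
    simp only [Real.norm_eq_abs, sq_abs]
    have h1 : x 0 ^ 2 + x 1 ^ 2 ≤ 1 := by
      rw [← cylRadius_sq]; exact pow_le_one₀ (cylRadius_nonneg x) hx.1
    have h2 : |x 2| ≤ |L| := by
      rw [abs_le]; constructor <;> cases' abs_cases L with h h <;> linarith [hx.2.1, hx.2.2]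
    calc Real.sqrt (x 0 ^ 2 + x 1 ^ 2 + x 2 ^ 2) ≤ Real.sqrt ((1 + |L|) ^ 2) := by
          apply Real.sqrt_le_sqrt
          have : x 2 ^ 2 ≤ |L| ^ 2 := by rw [← sq_abs (x 2)]; exact pow_le_pow_left₀ (abs_nonneg _) h2 2
          nlinarith [abs_nonneg L]
      _ = 1 + |L| := Real.sqrt_sq (by positivity)

/-- The closed fundamental block lies in the closed cylinder. [folklore] -/
theorem closedBlock_subset_K (L : ℝ) : {x : ℝ³ | cylRadius x ≤ 1 ∧ x 2 ∈ Icc 0 L} ⊆ 𝕂 := fun x hx => by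
  rw [closure_unitCylinder]; exact hx.1

/-- The axial reduction of a point of the closed cylinder lies in the closed fundamental block.
[folklore] -/
theorem axialRed_mem_closedBlock (hL : 0 < L) {x : ℝ³} (hx : x ∈ 𝕂) :
    axialRed L x ∈ {x : ℝ³ | cylRadius x ≤ 1 ∧ x 2 ∈ Icc 0 L} := by
  refine ⟨?_, (axialRed_apply_two_nonneg hL x), (axialRed_apply_two_lt hL x).le⟩
  rw [cylRadius_axialRed]
  rw [closure_unitCylinder] at hx
  exact hx

/-- **A continuous `L`-periodic function on the closed cylinder is bounded there** (reduce to the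
compact fundamental block by periodicity). [folklore] -/
theorem exists_forall_norm_le_of_periodic {F : Type*} [NormedAddCommGroup F] (hL : 0 < L) {g : ℝ³ → F}
    (hg : ContinuousOn g 𝕂) (hper : IsAxiallyPeriodic L g) : ∃ C : ℝ, 0 ≤ C ∧ ∀ x ∈ 𝕂, ‖g x‖ ≤ C := by
  obtain ⟨C, hC⟩ := (isCompact_closedBlock L).exists_bound_of_continuousOn
    (hg.mono (closedBlock_subset_K L))
  refine ⟨max C 0, le_max_right _ _, fun x hx => ?_⟩
  rw [← hper.comp_axialRed x]
  exact (hC _ (axialRed_mem_closedBlock hL hx)).trans (le_max_left _ _)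

/-- **A smooth periodic function has bounded derivative within the closed cylinder.** [folklore] -/
theorem exists_forall_norm_fderivWithin_le {F : Type*} [NormedAddCommGroup F] [NormedSpace ℝ F]
    (hL : 0 < L) {g : ℝ³ → F} (hg : IsSmoothPeriodic L g) :
    ∃ C : ℝ, 0 ≤ C ∧ ∀ x ∈ 𝕂, ‖fderivWithin ℝ g 𝕂 x‖ ≤ C :=
  exists_forall_norm_le_of_periodic hL
    ((hg.smooth.continuousOn_fderivWithin uniqueDiffOn_K (by simp))) hg.periodic.fderivWithin_closure

/-! ### `L²` convergence on the cell by dominated convergence -/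

/-- Cell classes agree for a.e. equal functions. [folklore] -/
theorem toCell_congr_ae {F : Type*} [NormedAddCommGroup F] {f g : ℝ³ → F}
    (h : f =ᵐ[cellMeasure L] g) : toCell L f = toCell L g := by
  by_cases hf : MemLp f 2 (cellMeasure L)
  · have hg : MemLp g 2 (cellMeasure L) := hf.ae_eq h
    rw [toCell_eq_toLp hf, toCell_eq_toLp hg]
    exact (MemLp.toLp_eq_toLp_iff hf hg).2 h
  · have hg : ¬ MemLp g 2 (cellMeasure L) := fun hg => hf (hg.ae_eq h.symm)
    simp [toCell, hf, hg]

/-- A function bounded on the cell and a.e. strongly measurable there is square integrable on the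
cell. [folklore] -/
theorem memLp_two_of_bound {F : Type*} [NormedAddCommGroup F] {f : ℝ³ → F}
    (hfm : AEStronglyMeasurable f (cellMeasure L)) {B : ℝ}
    (hB : ∀ x ∈ (cylinderCell L : Set ℝ³), ‖f x‖ ≤ B) : MemLp f 2 (cellMeasure L) :=
  MemLp.of_bound hfm B ((ae_restrict_mem (cylinderCell L).isOpen.measurableSet).mono fun x hx => hB x hx)

/-- **`L²(cell)` convergence by dominated convergence**: functions on the cell converging pointwise
on the cell under a common bound converge in `L²(cell)`. [folklore] -/
theorem tendsto_toCell_of_dominated {F : Type*} [NormedAddCommGroup F] [NormedSpace ℝ F]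
    {q : ℕ → ℝ³ → F} {q' : ℝ³ → F} {B : ℝ}
    (hqm : ∀ n, AEStronglyMeasurable (q n) (cellMeasure L)) (hq'm : AEStronglyMeasurable q' (cellMeasure L))
    (hB : ∀ n, ∀ x ∈ (cylinderCell L : Set ℝ³), ‖q n x‖ ≤ B)
    (hB' : ∀ x ∈ (cylinderCell L : Set ℝ³), ‖q' x‖ ≤ B)
    (hlim : ∀ x ∈ (cylinderCell L : Set ℝ³), Tendsto (fun n => q n x) atTop (𝓝 (q' x))) :
    Tendsto (fun n => toCell L (q n)) atTop (𝓝 (toCell L q')) := by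
  have hmem : ∀ n, MemLp (q n) 2 (cellMeasure L) := fun n => memLp_two_of_bound (hqm n) (hB n)
  have hmem' : MemLp q' 2 (cellMeasure L) := memLp_two_of_bound hq'm hB'
  rw [tendsto_iff_norm_sub_tendsto_zero]
  -- `‖[qₙ] − [q']‖ = √(∫ ‖qₙ − q'‖²)`
  have hnorm : ∀ n, ‖toCell L (q n) - toCell L q'‖ =
      Real.sqrt (∫ x in (cylinderCell L : Set ℝ³), ‖q n x - q' x‖ ^ 2) := fun n => by
    have hmn : MemLp (fun x => q n x - q' x) 2 (cellMeasure L) := (hmem n).sub hmem'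
    rw [← toCell_sub (hmem n) hmem', norm_toCell hmn, integral_norm_sq_eq_toReal_eLpNorm_two_sq hmn,
      Real.sqrt_sq ENNReal.toReal_nonneg]
  simp_rw [hnorm]
  rw [← Real.sqrt_zero]
  refine (Real.continuous_sqrt.tendsto 0).comp ?_
  -- dominated convergence for `∫ ‖qₙ − q'‖²`
  have h0 : (0 : ℝ) = ∫ x in (cylinderCell L : Set ℝ³), (fun _ => (0 : ℝ)) x := by simp
  rw [h0]
  refine tendsto_integral_of_dominated_convergence (fun _ => (2 * B) ^ 2)
    (fun n => ((hqm n).sub hq'm).norm.pow 2) (integrable_const _) (fun n => ?_) ?_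
  · filter_upwards [ae_restrict_mem (cylinderCell L).isOpen.measurableSet] with x hx
    rw [Real.norm_eq_abs, abs_pow, abs_norm]
    have h1 : ‖q n x - q' x‖ ≤ 2 * B := (norm_sub_le _ _).trans (by linarith [hB n x hx, hB' x hx])
    exact pow_le_pow_left₀ (norm_nonneg _) h1 2
  · filter_upwards [ae_restrict_mem (cylinderCell L).isOpen.measurableSet] with x hx
    have h1 : Tendsto (fun n => q n x - q' x) atTop (𝓝 0) := by
      have := (hlim x hx).sub_const (q' x)
      rwa [sub_self] at this
    have h2 := (continuous_norm.tendsto _).comp h1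
    rw [norm_zero] at h2
    have h3 := h2.pow 2
    rwa [zero_pow two_ne_zero] at h3

/-! ### Difference quotients of smooth periodic data converge in `L²(cell)` -/

section DataQuotients

variable {F : Type*} [NormedAddCommGroup F] [NormedSpace ℝ F]

/-- Points of the cell are interior points of the closed cylinder. [folklore] -/
theorem differentiableAt_of_isSmoothPeriodic {h : ℝ³ → F} (hh : IsSmoothPeriodic L h) {x : ℝ³}
    (hx : x ∈ (unitCylinder : Set ℝ³)) : DifferentiableAt ℝ h x :=
  ((hh.smooth.differentiableOn (by simp)).differentiableAt (closure_unitCylinder_mem_nhds hx))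

/-- **Axial difference quotients of smooth periodic data converge in `L²(cell)`** to the axial
derivative. [folklore] -/
theorem tendsto_toCell_axialQuot (hL : 0 < L) {h : ℝ³ → F} (hh : IsSmoothPeriodic L h)
    {a : ℕ → ℝ} (ha0 : ∀ n, a n ≠ 0) (ha : Tendsto a atTop (𝓝 0)) :
    Tendsto (fun n => toCell L (fun x => (a n)⁻¹ • (h (x + a n • eZ) - h x))) atTop
      (𝓝 (toCell L (cylDeriv (fun _ => eZ) h))) := by
  obtain ⟨C, hC0, hC⟩ := exists_forall_norm_fderivWithin_le hL hh
  have hcont : ∀ n, ContinuousOn (fun x => (a n)⁻¹ • (h (x + a n • eZ) - h x)) 𝕂 := fun n =>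
    (((hh.comp_add_smul_eZ (a n)).continuousOn).sub hh.continuousOn).const_smul _
  refine tendsto_toCell_of_dominated (B := C)
    (fun n => aestronglyMeasurable_cylinderCell_of_continuousOn L ((hcont n).mono subset_closure))
    (aestronglyMeasurable_cylinderCell_of_continuousOn L
      ((contDiffOn_cylDeriv contDiff_const hh.smooth).continuousOn.mono subset_closure))
    (fun n x hx => ?_) (fun x hx => ?_) (fun x hx => ?_)
  · -- mean value inequality within the convex closed cylinder along the axial segment
    have hxK : x ∈ 𝕂 := cell_subset_K hx
    have hyK : x + a n • eZ ∈ 𝕂 := (add_axialShift_mem_closure_unitCylinder_iff (a n)).2 hxK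
    have hmv := (convex_unitCylinder.closure).norm_image_sub_le_of_norm_fderivWithin_le
      (hh.smooth.differentiableOn (by simp)) (fun y hy => hC y hy) hxK hyK
    rw [add_sub_cancel_left, norm_smul, Real.norm_eq_abs] at hmv
    rw [norm_smul, norm_inv, Real.norm_eq_abs]
    have hnorm : ‖(eZ : ℝ³)‖ = 1 := by rw [eZ_eq_single, PiLp.norm_single, norm_one]
    rw [hnorm, mul_one] at hmv
    have hapos : 0 < |a n| := abs_pos.2 (ha0 n)
    calc |a n|⁻¹ * ‖h (x + a n • eZ) - h x‖ ≤ |a n|⁻¹ * (C * |a n|) := by gcongr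
      _ = C := by field_simp
  · rw [cylDeriv_apply]
    exact ((fderivWithin ℝ h 𝕂 x).le_opNorm _).trans (by
      rw [show ‖(eZ : ℝ³)‖ = 1 by rw [eZ_eq_single, PiLp.norm_single, norm_one], mul_one]
      exact hC x (cell_subset_K hx))
  · -- pointwise: derivative of `t ↦ h (x + t e_z)` at `0`
    have hxU : x ∈ (unitCylinder : Set ℝ³) := cylinderCell_le_unitCylinder L hx
    have hd : HasDerivAt (fun t : ℝ => h (x + t • eZ)) (fderiv ℝ h x eZ) 0 := by
      have h1 : HasDerivAt (fun t : ℝ => x + t • eZ) eZ 0 := by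
        simpa using ((hasDerivAt_id (0 : ℝ)).smul_const (eZ : ℝ³)).const_add x
      have h2 : HasFDerivAt h (fderiv ℝ h x) (x + (0 : ℝ) • eZ) := by
        rw [zero_smul, add_zero]; exact (differentiableAt_of_isSmoothPeriodic hh hxU).hasFDerivAt
      exact h2.comp_hasDerivAt (0 : ℝ) h1
    have hs := hd.tendsto_slope_zero
    have ha' : Tendsto a atTop (𝓝[≠] 0) :=
      tendsto_nhdsWithin_iff.2 ⟨ha, Eventually.of_forall fun n => ha0 n⟩
    have := hs.comp ha'
    rw [cylDeriv_eq_fderiv _ _ hxU]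
    refine this.congr fun n => ?_
    simp

/-- **Rotational difference quotients of smooth periodic data converge in `L²(cell)`** to the
derivative along the generator. [folklore] -/
theorem tendsto_toCell_rotQuot {h : ℝ³ → F} (hh : IsSmoothPeriodic L h)
    {θ : ℕ → ℝ} (hθ0 : ∀ n, θ n ≠ 0) (hθ : Tendsto θ atTop (𝓝 0)) (hL : 0 < L) :
    Tendsto (fun n => toCell L (fun x => (θ n)⁻¹ • (h (rotZ (θ n) x) - h x))) atTop
      (𝓝 (toCell L (cylDeriv rotGen h))) := by
  obtain ⟨C, hC0, hC⟩ := exists_forall_norm_fderivWithin_le hL hh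
  have hcont : ∀ n, ContinuousOn (fun x => (θ n)⁻¹ • (h (rotZ (θ n) x) - h x)) 𝕂 := fun n =>
    (((hh.comp_rotZ (θ n)).continuousOn).sub hh.continuousOn).const_smul _
  refine tendsto_toCell_of_dominated (B := C)
    (fun n => aestronglyMeasurable_cylinderCell_of_continuousOn L ((hcont n).mono subset_closure))
    (aestronglyMeasurable_cylinderCell_of_continuousOn L
      ((contDiffOn_cylDeriv contDiff_rotGen hh.smooth).continuousOn.mono subset_closure))
    (fun n x hx => ?_) (fun x hx => ?_) (fun x hx => ?_)
  · -- mean value along the rotation orbit, which stays in the open cylinder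
    have hxU : x ∈ (unitCylinder : Set ℝ³) := cylinderCell_le_unitCylinder L hx
    have hk : ∀ s, HasDerivAt (fun s => h (rotZ s x))
        (fderiv ℝ h (rotZ s x) (-Real.sin s • (toLp 2 ![x 0, x 1, 0] : ℝ³) + Real.cos s • rotGen x)) s :=
      fun s => (differentiableAt_of_isSmoothPeriodic hh ((rotZ_mem_unitCylinder_iff s).2 hxU)).hasFDerivAt.comp_hasDerivAt s (hasDerivAt_rotZ x s)
    have hrot : ∀ s : ℝ, -Real.sin s • (toLp 2 ![x 0, x 1, 0] : ℝ³) + Real.cos s • rotGen x =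
        rotGen (rotZ s x) := fun s => by
      ext i; fin_cases i <;> simp [rotGen] <;> ring
    have hk' : ∀ s, ‖deriv (fun s => h (rotZ s x)) s‖ ≤ C := fun s => by
      rw [(hk s).deriv, hrot]
      have hyU : rotZ s x ∈ (unitCylinder : Set ℝ³) := (rotZ_mem_unitCylinder_iff s).2 hxU
      have hyK : rotZ s x ∈ 𝕂 := subset_closure hyU
      rw [← fderivWithin_of_mem_nhds (closure_unitCylinder_mem_nhds hyU)]
      refine ((fderivWithin ℝ h 𝕂 (rotZ s x)).le_opNorm _).trans ?_
      rw [norm_rotGen_eq_cylRadius, cylRadius_rotZ]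
      calc ‖fderivWithin ℝ h 𝕂 (rotZ s x)‖ * cylRadius x ≤ C * 1 :=
            mul_le_mul (hC _ hyK) hx.1.le (cylRadius_nonneg x) hC0
        _ = C := mul_one C
    have hmv := Convex.norm_image_sub_le_of_norm_deriv_le (f := fun s => h (rotZ s x))
      (fun s _ => (hk s).differentiableAt) (fun s _ => hk' s) convex_univ (mem_univ (0 : ℝ)) (mem_univ (θ n))
    simp only [rotZ_zero, sub_zero] at hmv
    rw [norm_smul, norm_inv, Real.norm_eq_abs]
    have hapos : 0 < |θ n| := abs_pos.2 (hθ0 n)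
    calc |θ n|⁻¹ * ‖h (rotZ (θ n) x) - h x‖ ≤ |θ n|⁻¹ * (C * ‖θ n‖) := by gcongr
      _ = C := by rw [Real.norm_eq_abs]; field_simp
  · rw [cylDeriv_apply]
    refine ((fderivWithin ℝ h 𝕂 x).le_opNorm _).trans ?_
    rw [norm_rotGen_eq_cylRadius]
    calc ‖fderivWithin ℝ h 𝕂 x‖ * cylRadius x ≤ C * 1 :=
          mul_le_mul (hC x (cell_subset_K hx)) hx.1.le (cylRadius_nonneg x) hC0
      _ = C := mul_one C
  · have hxU : x ∈ (unitCylinder : Set ℝ³) := cylinderCell_le_unitCylinder L hx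
    have hd : HasDerivAt (fun t : ℝ => h (rotZ t x)) (fderiv ℝ h x (rotGen x)) 0 := by
      have h2 := (differentiableAt_of_isSmoothPeriodic hh hxU).hasFDerivAt
      rw [show x = rotZ 0 x by rw [rotZ_zero]] at h2
      have := h2.comp_hasDerivAt (0 : ℝ) (hasDerivAt_rotZ_zero x)
      simpa [rotZ_zero, Function.comp_def] using this
    have hs := hd.tendsto_slope_zero
    have hθ' : Tendsto θ atTop (𝓝[≠] 0) :=
      tendsto_nhdsWithin_iff.2 ⟨hθ, Eventually.of_forall fun n => hθ0 n⟩
    have := hs.comp hθ'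
    rw [cylDeriv_eq_fderiv _ _ hxU]
    refine this.congr fun n => ?_
    simp [rotZ_zero]

/-- The cylindrical radius is at most the norm. [folklore] -/
theorem cylRadius_le_norm (w : ℝ³) : cylRadius w ≤ ‖w‖ := by
  rw [cylRadius, EuclideanSpace.norm_eq, Fin.sum_univ_three]
  simp only [Real.norm_eq_abs, sq_abs]
  exact Real.sqrt_le_sqrt (by nlinarith [sq_nonneg (w 2)])

/-- `‖R_θ w − w‖ ≤ |θ| ‖w‖`: the orbit `s ↦ R_s w` has speed `r(w) ≤ ‖w‖`. [folklore] -/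
theorem norm_rotZ_sub_self_le (θ : ℝ) (w : ℝ³) : ‖rotZ θ w - w‖ ≤ |θ| * ‖w‖ := by
  have hrot : ∀ s : ℝ, -Real.sin s • (toLp 2 ![w 0, w 1, 0] : ℝ³) + Real.cos s • rotGen w =
      rotGen (rotZ s w) := fun s => by
    ext i; fin_cases i <;> simp [rotGen] <;> ring
  have hk : ∀ s, HasDerivAt (fun s => rotZ s w) (rotGen (rotZ s w)) s := fun s => by
    rw [← hrot s]; exact hasDerivAt_rotZ w s
  have hk' : ∀ s, ‖deriv (fun s => rotZ s w) s‖ ≤ ‖w‖ := fun s => by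
    rw [(hk s).deriv, norm_rotGen_eq_cylRadius, cylRadius_rotZ]
    exact cylRadius_le_norm w
  have hmv := Convex.norm_image_sub_le_of_norm_deriv_le (f := fun s => rotZ s w)
    (fun s _ => (hk s).differentiableAt) (fun s _ => hk' s) convex_univ (mem_univ (0 : ℝ)) (mem_univ θ)
  simp only [rotZ_zero, sub_zero, Real.norm_eq_abs] at hmv
  linarith [hmv, mul_comm (|θ|) ‖w‖]


/-- **Rotational difference quotients of a smooth periodic field, values rotated back, converge in
`L²(cell)`** to `∂_J h − J h`: `θ⁻¹(R_{−θ} h(R_θ x) − h x) → Dh(x)(Jx) − J(h x)`, by the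
decomposition `R_{−θ}[h(R_θ x) − h x] + (R_{−θ} − 1) h x`. [folklore] -/
theorem tendsto_toCell_rotFieldQuot {h : ℝ³ → ℝ³} (hh : IsSmoothPeriodic L h)
    {θ : ℕ → ℝ} (hθ0 : ∀ n, θ n ≠ 0) (hθ : Tendsto θ atTop (𝓝 0)) (hL : 0 < L) :
    Tendsto (fun n => toCell L (fun x => (θ n)⁻¹ • (rotZ (-θ n) (h (rotZ (θ n) x)) - h x))) atTop
      (𝓝 (toCell L (fun x => cylDeriv rotGen h x - rotGen (h x)))) := by
  obtain ⟨C, hC0, hC⟩ := exists_forall_norm_fderivWithin_le hL hh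
  obtain ⟨B, hB0, hB⟩ := exists_forall_norm_le_of_periodic hL hh.continuousOn hh.periodic
  have hcont : ∀ n, ContinuousOn (fun x => (θ n)⁻¹ • (rotZ (-θ n) (h (rotZ (θ n) x)) - h x)) 𝕂 := fun n => by
    refine ContinuousOn.const_smul (ContinuousOn.sub ?_ hh.continuousOn) (θ n)⁻¹
    exact (hh.rotZ_comp_rotZ (θ n)).continuousOn
  have hlimc : ContinuousOn (fun x => cylDeriv rotGen h x - rotGen (h x)) 𝕂 :=
    (contDiffOn_cylDeriv contDiff_rotGen hh.smooth).continuousOn.sub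
      ((rotGenL).continuous.comp_continuousOn hh.continuousOn)
  refine tendsto_toCell_of_dominated (B := C + B)
    (fun n => aestronglyMeasurable_cylinderCell_of_continuousOn L ((hcont n).mono subset_closure))
    (aestronglyMeasurable_cylinderCell_of_continuousOn L (hlimc.mono subset_closure))
    (fun n x hx => ?_) (fun x hx => ?_) (fun x hx => ?_)
  · -- bound via the decomposition
    have hxU : x ∈ (unitCylinder : Set ℝ³) := cylinderCell_le_unitCylinder L hx
    have hxK : x ∈ 𝕂 := cell_subset_K hx
    have hdec : (θ n)⁻¹ • (rotZ (-θ n) (h (rotZ (θ n) x)) - h x) =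
        rotZ (-θ n) ((θ n)⁻¹ • (h (rotZ (θ n) x) - h x)) + (θ n)⁻¹ • (rotZ (-θ n) (h x) - h x) := by
      have hlin : ∀ (c : ℝ) (u v : ℝ³), rotZ (-θ n) (c • (u - v)) = c • (rotZ (-θ n) u - rotZ (-θ n) v) :=
        fun c u v => by rw [← rotZL_apply, map_smul, map_sub]; rfl
      rw [hlin, ← smul_add]
      congr 1
      abel
    rw [hdec]
    refine (norm_add_le _ _).trans (add_le_add ?_ ?_)
    · rw [norm_rotZ, norm_smul, norm_inv, Real.norm_eq_abs]
      -- `‖h(R_θ x) − h x‖ ≤ C |θ|` along the orbit (as in the scalar case)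
      have hk : ∀ s, HasDerivAt (fun s => h (rotZ s x))
          (fderiv ℝ h (rotZ s x) (-Real.sin s • (toLp 2 ![x 0, x 1, 0] : ℝ³) + Real.cos s • rotGen x)) s :=
        fun s => (differentiableAt_of_isSmoothPeriodic hh ((rotZ_mem_unitCylinder_iff s).2 hxU)).hasFDerivAt.comp_hasDerivAt s (hasDerivAt_rotZ x s)
      have hrot : ∀ s : ℝ, -Real.sin s • (toLp 2 ![x 0, x 1, 0] : ℝ³) + Real.cos s • rotGen x =
          rotGen (rotZ s x) := fun s => by
        ext i; fin_cases i <;> simp [rotGen] <;> ring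
      have hk' : ∀ s, ‖deriv (fun s => h (rotZ s x)) s‖ ≤ C := fun s => by
        rw [(hk s).deriv, hrot]
        have hyU : rotZ s x ∈ (unitCylinder : Set ℝ³) := (rotZ_mem_unitCylinder_iff s).2 hxU
        have hyK : rotZ s x ∈ 𝕂 := subset_closure hyU
        rw [← fderivWithin_of_mem_nhds (closure_unitCylinder_mem_nhds hyU)]
        refine ((fderivWithin ℝ h 𝕂 (rotZ s x)).le_opNorm _).trans ?_
        rw [norm_rotGen_eq_cylRadius, cylRadius_rotZ]
        calc ‖fderivWithin ℝ h 𝕂 (rotZ s x)‖ * cylRadius x ≤ C * 1 :=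
              mul_le_mul (hC _ hyK) hx.1.le (cylRadius_nonneg x) hC0
          _ = C := mul_one C
      have hmv := Convex.norm_image_sub_le_of_norm_deriv_le (f := fun s => h (rotZ s x))
        (fun s _ => (hk s).differentiableAt) (fun s _ => hk' s) convex_univ (mem_univ (0 : ℝ)) (mem_univ (θ n))
      simp only [rotZ_zero, sub_zero, Real.norm_eq_abs] at hmv
      have hapos : 0 < |θ n| := abs_pos.2 (hθ0 n)
      calc |θ n|⁻¹ * ‖h (rotZ (θ n) x) - h x‖ ≤ |θ n|⁻¹ * (C * |θ n|) := by gcongr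
        _ = C := by field_simp
    · rw [norm_smul, norm_inv, Real.norm_eq_abs]
      have h1 := norm_rotZ_sub_self_le (-θ n) (h x)
      rw [abs_neg] at h1
      have hapos : 0 < |θ n| := abs_pos.2 (hθ0 n)
      calc |θ n|⁻¹ * ‖rotZ (-θ n) (h x) - h x‖ ≤ |θ n|⁻¹ * (|θ n| * ‖h x‖) := by gcongr
        _ = ‖h x‖ := by field_simp
        _ ≤ B := hB x hxK
  · have hxK : x ∈ 𝕂 := cell_subset_K hx
    refine (norm_sub_le _ _).trans (add_le_add ?_ ?_)
    · rw [cylDeriv_apply]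
      refine ((fderivWithin ℝ h 𝕂 x).le_opNorm _).trans ?_
      rw [norm_rotGen_eq_cylRadius]
      calc ‖fderivWithin ℝ h 𝕂 x‖ * cylRadius x ≤ C * 1 :=
            mul_le_mul (hC x hxK) hx.1.le (cylRadius_nonneg x) hC0
        _ = C := mul_one C
    · rw [norm_rotGen_eq_cylRadius]
      exact (cylRadius_le_norm _).trans (hB x hxK)
  · -- pointwise convergence of the two pieces
    have hxU : x ∈ (unitCylinder : Set ℝ³) := cylinderCell_le_unitCylinder L hx
    have hθ' : Tendsto θ atTop (𝓝[≠] 0) :=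
      tendsto_nhdsWithin_iff.2 ⟨hθ, Eventually.of_forall fun n => hθ0 n⟩
    -- piece 1: `θ⁻¹(h(R_θ x) − h x) → Dh(x)(Jx)`, then rotate back by `R_{−θₙ} → 1`
    have hd : HasDerivAt (fun t : ℝ => h (rotZ t x)) (fderiv ℝ h x (rotGen x)) 0 := by
      have h2 := (differentiableAt_of_isSmoothPeriodic hh hxU).hasFDerivAt
      rw [show x = rotZ 0 x by rw [rotZ_zero]] at h2
      have := h2.comp_hasDerivAt (0 : ℝ) (hasDerivAt_rotZ_zero x)
      simpa [rotZ_zero, Function.comp_def] using this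
    have hq1 : Tendsto (fun n => (θ n)⁻¹ • (h (rotZ (θ n) x) - h x)) atTop (𝓝 (fderiv ℝ h x (rotGen x))) := by
      have := hd.tendsto_slope_zero.comp hθ'
      refine this.congr fun n => ?_
      simp [rotZ_zero]
    obtain ⟨w, hw⟩ : ∃ w : ℝ³, fderiv ℝ h x (rotGen x) = w := ⟨_, rfl⟩
    rw [hw] at hq1
    have hrotc : Tendsto (fun n => rotZ (-θ n) ((θ n)⁻¹ • (h (rotZ (θ n) x) - h x))) atTop (𝓝 w) := by
      -- `‖R_{−θ} wₙ − w‖ ≤ ‖wₙ − w‖ + |θ| ‖w‖`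
      rw [tendsto_iff_norm_sub_tendsto_zero]
      have hb : ∀ n, ‖rotZ (-θ n) ((θ n)⁻¹ • (h (rotZ (θ n) x) - h x)) - w‖ ≤
          ‖(θ n)⁻¹ • (h (rotZ (θ n) x) - h x) - w‖ + |θ n| * ‖w‖ := fun n => by
        have hsub : ∀ u v : ℝ³, rotZ (-θ n) (u - v) = rotZ (-θ n) u - rotZ (-θ n) v := fun u v => by
          rw [← rotZL_apply, map_sub]; rfl
        have h1 : rotZ (-θ n) ((θ n)⁻¹ • (h (rotZ (θ n) x) - h x)) - w =
            rotZ (-θ n) ((θ n)⁻¹ • (h (rotZ (θ n) x) - h x) - w) + (rotZ (-θ n) w - w) := by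
          rw [hsub]; abel
        rw [h1]
        refine (norm_add_le _ _).trans (add_le_add ?_ ?_)
        · rw [norm_rotZ]
        · have := norm_rotZ_sub_self_le (-θ n) w; rwa [abs_neg] at this
      have h0 : Tendsto (fun n => ‖(θ n)⁻¹ • (h (rotZ (θ n) x) - h x) - w‖ + |θ n| * ‖w‖) atTop (𝓝 0) := by
        have t1 := tendsto_iff_norm_sub_tendsto_zero.1 hq1
        have t2 : Tendsto (fun n => |θ n| * ‖w‖) atTop (𝓝 0) := by
          have := hθ.abs.mul_const ‖w‖
          rwa [abs_zero, zero_mul] at this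
        simpa using t1.add t2
      exact squeeze_zero (fun n => norm_nonneg _) hb h0
    -- piece 2: `θ⁻¹(R_{−θ} v − v) → −J v`
    have hq2 : Tendsto (fun n => (θ n)⁻¹ • (rotZ (-θ n) (h x) - h x)) atTop (𝓝 (-rotGen (h x))) := by
      have hd2 : HasDerivAt (fun t : ℝ => rotZ (-t) (h x)) (-rotGen (h x)) 0 := by
        have hγ' : HasDerivAt (fun t : ℝ => rotZ t (h x)) (rotGen (h x)) (-(0 : ℝ)) := by
          rw [neg_zero]; exact hasDerivAt_rotZ_zero (h x)
        have hh := hγ'.scomp (0 : ℝ) (hasDerivAt_neg (0 : ℝ))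
        simp only [neg_one_smul] at hh
        exact hh
      have := hd2.tendsto_slope_zero.comp hθ'
      refine this.congr fun n => ?_
      simp [rotZ_zero]
    have hsum := hrotc.add hq2
    rw [← sub_eq_add_neg] at hsum
    rw [cylDeriv_eq_fderiv _ _ hxU, hw]
    refine hsum.congr fun n => ?_
    have hlin : ∀ (c : ℝ) (u v : ℝ³), rotZ (-θ n) (c • (u - v)) = c • (rotZ (-θ n) u - rotZ (-θ n) v) :=
      fun c u v => by rw [← rotZL_apply, map_smul, map_sub]; rfl
    rw [hlin, ← smul_add]
    congr 1
    abel

end DataQuotients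

/-! ### The weak Neumann solution with smooth periodic data: difference quotients -/

section Assembly

/-- The cell class of a difference quotient. [folklore] -/
theorem toCell_quot {F : Type*} [NormedAddCommGroup F] [NormedSpace ℝ F] {f g : ℝ³ → F}
    (hf : MemLp f 2 (cellMeasure L)) (hg : MemLp g 2 (cellMeasure L)) (c : ℝ) :
    toCell L (fun x => c • (f x - g x)) = c • (toCell L f - toCell L g) := by
  rw [← toCell_sub hf hg, ← toCell_const_smul (f := fun x => f x - g x) c (hf.sub hg)]

/-- **Axial difference quotients of the weak solution are weak solutions**:
`a⁻¹(U_a ∇q − ∇q) = ∇q[a⁻¹(h₀(·+ae_z) − h₀), a⁻¹(h₁(·+ae_z) − h₁)]`. [folklore] -/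
theorem axialQuot_coe_neumannGrad (hL : 0 < L) {h₀ : ℝ³ → ℝ} {h₁ : ℝ³ → ℝ³}
    (hh₀ : IsSmoothPeriodic L h₀) (hh₁ : IsSmoothPeriodic L h₁) (a : ℝ) :
    a⁻¹ • (axialShiftLp L a ((neumannGrad L (toCell L h₀) (toCell L h₁) : gradSpace L) : Lp ℝ³ 2 (cellMeasure L)) -
        (neumannGrad L (toCell L h₀) (toCell L h₁) : Lp ℝ³ 2 (cellMeasure L))) =
      ((neumannGrad L (toCell L (fun x => a⁻¹ • (h₀ (x + a • eZ) - h₀ x)))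
        (toCell L (fun x => a⁻¹ • (h₁ (x + a • eZ) - h₁ x))) : gradSpace L) : Lp ℝ³ 2 (cellMeasure L)) := by
  have e0 : toCell L (fun x => a⁻¹ • (h₀ (x + a • eZ) - h₀ x)) =
      a⁻¹ • (axialShiftLp L a (toCell L h₀) - toCell L h₀) := by
    rw [axialShiftLp_toCell hL a hh₀.periodic hh₀.memLp]
    exact toCell_quot (hh₀.comp_add_smul_eZ a).memLp hh₀.memLp a⁻¹
  have e1 : toCell L (fun x => a⁻¹ • (h₁ (x + a • eZ) - h₁ x)) =
      a⁻¹ • (axialShiftLp L a (toCell L h₁) - toCell L h₁) := by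
    rw [axialShiftLp_toCell hL a hh₁.periodic hh₁.memLp]
    exact toCell_quot (hh₁.comp_add_smul_eZ a).memLp hh₁.memLp a⁻¹
  rw [e0, e1, neumannGrad_smul, neumannGrad_sub, Submodule.coe_smul, Submodule.coe_sub,
    coe_neumannGrad_axialShiftLp hL]

/-- **Rotational difference quotients of the weak solution are weak solutions**:
`θ⁻¹(R_θ ∇q − ∇q) = ∇q[θ⁻¹(h₀∘R_θ − h₀), θ⁻¹(R_{−θ}h₁∘R_θ − h₁)]`. [folklore] -/
theorem rotQuot_coe_neumannGrad (hL : 0 < L) {h₀ : ℝ³ → ℝ} {h₁ : ℝ³ → ℝ³}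
    (hh₀ : IsSmoothPeriodic L h₀) (hh₁ : IsSmoothPeriodic L h₁) (θ : ℝ) :
    θ⁻¹ • (rotFieldLp L θ ((neumannGrad L (toCell L h₀) (toCell L h₁) : gradSpace L) : Lp ℝ³ 2 (cellMeasure L)) -
        (neumannGrad L (toCell L h₀) (toCell L h₁) : Lp ℝ³ 2 (cellMeasure L))) =
      ((neumannGrad L (toCell L (fun x => θ⁻¹ • (h₀ (rotZ θ x) - h₀ x)))
        (toCell L (fun x => θ⁻¹ • (rotZ (-θ) (h₁ (rotZ θ x)) - h₁ x))) : gradSpace L) :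
          Lp ℝ³ 2 (cellMeasure L)) := by
  have e0 : toCell L (fun x => θ⁻¹ • (h₀ (rotZ θ x) - h₀ x)) = θ⁻¹ • (rotLp L θ (toCell L h₀) - toCell L h₀) := by
    rw [rotLp_toCell θ hh₀.memLp]
    exact toCell_quot (hh₀.comp_rotZ θ).memLp hh₀.memLp θ⁻¹
  have e1 : toCell L (fun x => θ⁻¹ • (rotZ (-θ) (h₁ (rotZ θ x)) - h₁ x)) =
      θ⁻¹ • (rotFieldLp L θ (toCell L h₁) - toCell L h₁) := by
    rw [rotFieldLp_toCell θ hh₁.memLp]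
    exact toCell_quot (hh₁.rotZ_comp_rotZ θ).memLp hh₁.memLp θ⁻¹
  rw [e0, e1, neumannGrad_smul, neumannGrad_sub, Submodule.coe_smul, Submodule.coe_sub,
    coe_neumannGrad_rotFieldLp hL]

/-- **The axial weak derivative of the weak Neumann solution**: for smooth periodic data, the weak
solution `∇q[h₀, h₁]` has, along `e_z` on the open cell, the weak derivative `∇q[∂_z h₀, ∂_z h₁]` —
the difference quotients are the weak solutions for the difference quotients of the data
(`axialQuot_coe_neumannGrad`), which converge in `L²` (`tendsto_toCell_axialQuot`), and the solution
map is continuous (`tendsto_coe_neumannGrad`); `hasWeakDerivAlong_eZ_of_tendsto` concludes.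
[folklore] -/
theorem hasWeakDerivAlong_eZ_neumannGrad (hL : 0 < L) {h₀ : ℝ³ → ℝ} {h₁ : ℝ³ → ℝ³}
    (hh₀ : IsSmoothPeriodic L h₀) (hh₁ : IsSmoothPeriodic L h₁) :
    HasWeakDerivAlong (cylinderCell L) volume (fun _ => eZ)
      (((neumannGrad L (toCell L h₀) (toCell L h₁) : gradSpace L) : Lp ℝ³ 2 (cellMeasure L)) : ℝ³ → ℝ³)
      (((neumannGrad L (toCell L (cylDeriv (fun _ => eZ) h₀)) (toCell L (cylDeriv (fun _ => eZ) h₁)) :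
        gradSpace L) : Lp ℝ³ 2 (cellMeasure L)) : ℝ³ → ℝ³) := by
  set a : ℕ → ℝ := fun n => ((n : ℝ) + 1)⁻¹ with ha_def
  have ha0 : ∀ n, a n ≠ 0 := fun n => inv_ne_zero (by positivity)
  have ha : Tendsto a atTop (𝓝 0) := tendsto_one_div_add_atTop_nhds_zero_nat.congr fun n => by
    simp [ha_def, one_div]
  refine hasWeakDerivAlong_eZ_of_tendsto hL _ _ ha0 ha ?_
  have hlim := tendsto_coe_neumannGrad (tendsto_toCell_axialQuot hL hh₀ ha0 ha)
    (tendsto_toCell_axialQuot hL hh₁ ha0 ha)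
  refine hlim.congr fun n => ?_
  exact (axialQuot_coe_neumannGrad hL hh₀ hh₁ (a n)).symm

/-- **The rotational difference quotients of the weak Neumann solution converge** in `L²(cell; ℝ³)`
to `∇q[∂_J h₀, ∂_J h₁ − J h₁]`. [folklore] -/
theorem tendsto_rotQuot_coe_neumannGrad (hL : 0 < L) {h₀ : ℝ³ → ℝ} {h₁ : ℝ³ → ℝ³}
    (hh₀ : IsSmoothPeriodic L h₀) (hh₁ : IsSmoothPeriodic L h₁) {θ : ℕ → ℝ} (hθ0 : ∀ n, θ n ≠ 0)
    (hθ : Tendsto θ atTop (𝓝 0)) :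
    Tendsto (fun n => (θ n)⁻¹ • (rotFieldLp L (θ n)
        ((neumannGrad L (toCell L h₀) (toCell L h₁) : gradSpace L) : Lp ℝ³ 2 (cellMeasure L)) -
        (neumannGrad L (toCell L h₀) (toCell L h₁) : Lp ℝ³ 2 (cellMeasure L)))) atTop
      (𝓝 ((neumannGrad L (toCell L (cylDeriv rotGen h₀))
        (toCell L (fun x => cylDeriv rotGen h₁ x - rotGen (h₁ x))) : gradSpace L) : Lp ℝ³ 2 (cellMeasure L))) := by
  have hlim := tendsto_coe_neumannGrad (tendsto_toCell_rotQuot hh₀ hθ0 hθ hL)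
    (tendsto_toCell_rotFieldQuot hh₁ hθ0 hθ hL)
  refine hlim.congr fun n => ?_
  exact (rotQuot_coe_neumannGrad hL hh₀ hh₁ (θ n)).symm

end Assembly

/-! ### Pairings with equivariant fields: weak rotational derivatives of the frame components -/

section Pairings

/-- `|⟪V x, w⟫| ≤ B ‖w‖` on the cell gives `‖[⟪V, u⟫]‖ ≤ B ‖u‖` in `L²(cell)`. [folklore] -/
theorem norm_toCell_inner_le {V : ℝ³ → ℝ³} (hVc : Continuous V) {B : ℝ} (hB0 : 0 ≤ B)
    (hVB : ∀ x ∈ (cylinderCell L : Set ℝ³), ‖V x‖ ≤ B) (u : Lp ℝ³ 2 (cellMeasure L)) :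
    MemLp (fun x => ⟪V x, (u : ℝ³ → ℝ³) x⟫) 2 (cellMeasure L) ∧
      ‖toCell L (fun x => ⟪V x, (u : ℝ³ → ℝ³) x⟫)‖ ≤ B * ‖u‖ := by
  have hmeas : AEStronglyMeasurable (fun x => ⟪V x, (u : ℝ³ → ℝ³) x⟫) (cellMeasure L) :=
    hVc.aestronglyMeasurable.inner (Lp.aestronglyMeasurable u)
  have hbound : ∀ᵐ x ∂(cellMeasure L), ‖⟪V x, (u : ℝ³ → ℝ³) x⟫‖ ≤ B * ‖(u : ℝ³ → ℝ³) x‖ := by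
    filter_upwards [ae_restrict_mem (cylinderCell L).isOpen.measurableSet] with x hx
    exact (norm_inner_le_norm _ _).trans (mul_le_mul_of_nonneg_right (hVB x hx) (norm_nonneg _))
  have hmem : MemLp (fun x => ⟪V x, (u : ℝ³ → ℝ³) x⟫) 2 (cellMeasure L) := (Lp.memLp u).of_le_mul hmeas hbound
  refine ⟨hmem, ?_⟩
  rw [norm_toCell hmem, Lp.norm_def]
  have h := eLpNorm_le_mul_eLpNorm_of_ae_le_mul hbound 2
  have hfin : eLpNorm (u : ℝ³ → ℝ³) 2 (cellMeasure L) ≠ ⊤ := (Lp.memLp u).eLpNorm_ne_top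
  calc (eLpNorm (fun x => ⟪V x, (u : ℝ³ → ℝ³) x⟫) 2 (cellMeasure L)).toReal
      ≤ (ENNReal.ofReal B * eLpNorm (u : ℝ³ → ℝ³) 2 (cellMeasure L)).toReal :=
        ENNReal.toReal_mono (ENNReal.mul_ne_top ENNReal.ofReal_ne_top hfin) h
    _ = B * (eLpNorm (u : ℝ³ → ℝ³) 2 (cellMeasure L)).toReal := by
        rw [ENNReal.toReal_mul, ENNReal.toReal_ofReal hB0]

/-- **Continuity of the pairing** `u ↦ [⟪V, u⟫]` from `L²(cell; ℝ³)` to `L²(cell)`. [folklore] -/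
theorem tendsto_toCell_inner {V : ℝ³ → ℝ³} (hVc : Continuous V) {B : ℝ} (hB0 : 0 ≤ B)
    (hVB : ∀ x ∈ (cylinderCell L : Set ℝ³), ‖V x‖ ≤ B) {ι : Type*} {l : Filter ι}
    {u : ι → Lp ℝ³ 2 (cellMeasure L)} {u' : Lp ℝ³ 2 (cellMeasure L)} (h : Tendsto u l (𝓝 u')) :
    Tendsto (fun i => toCell L (fun x => ⟪V x, (u i : ℝ³ → ℝ³) x⟫)) l
      (𝓝 (toCell L (fun x => ⟪V x, (u' : ℝ³ → ℝ³) x⟫))) := by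
  rw [tendsto_iff_norm_sub_tendsto_zero]
  have hb : ∀ i, ‖toCell L (fun x => ⟪V x, (u i : ℝ³ → ℝ³) x⟫) -
      toCell L (fun x => ⟪V x, (u' : ℝ³ → ℝ³) x⟫)‖ ≤ B * ‖u i - u'‖ := fun i => by
    have h1 := (norm_toCell_inner_le hVc hB0 hVB (u i)).1
    have h2 := (norm_toCell_inner_le hVc hB0 hVB u').1
    rw [← toCell_sub h1 h2]
    have heq : toCell L (fun x => ⟪V x, (u i : ℝ³ → ℝ³) x⟫ - ⟪V x, (u' : ℝ³ → ℝ³) x⟫) =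
        toCell L (fun x => ⟪V x, ((u i - u' : Lp ℝ³ 2 (cellMeasure L)) : ℝ³ → ℝ³) x⟫) := by
      refine toCell_congr_ae ?_
      filter_upwards [Lp.coeFn_sub (u i) u'] with x hx
      rw [hx, Pi.sub_apply, inner_sub_right]
    rw [heq]
    exact (norm_toCell_inner_le hVc hB0 hVB (u i - u')).2
  have h0 : Tendsto (fun i => B * ‖u i - u'‖) l (𝓝 0) := by
    have := (tendsto_iff_norm_sub_tendsto_zero.1 h).const_mul B
    rwa [mul_zero] at this
  exact squeeze_zero (fun i => norm_nonneg _) hb h0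

/-- **The rotation of a pairing with an equivariant field**: for `V` with `V(R_θ x) = R_θ V(x)`,
`R_θ [⟪V, G⟫] = [⟪V, R_θ G⟫]` (scalar action on the left, field action on the right). [folklore] -/
theorem rotLp_toCell_inner_equivariant {V : ℝ³ → ℝ³} (hVc : Continuous V)
    (hVeq : ∀ (θ : ℝ) (x : ℝ³), V (rotZ θ x) = rotZ θ (V x)) {B : ℝ} (hB0 : 0 ≤ B)
    (hVB : ∀ x ∈ (cylinderCell L : Set ℝ³), ‖V x‖ ≤ B) (θ : ℝ) (G : Lp ℝ³ 2 (cellMeasure L)) :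
    rotLp L θ (toCell L (fun x => ⟪V x, (G : ℝ³ → ℝ³) x⟫)) =
      toCell L (fun x => ⟪V x, ((rotFieldLp L θ G : Lp ℝ³ 2 (cellMeasure L)) : ℝ³ → ℝ³) x⟫) := by
  have h1 := (norm_toCell_inner_le hVc hB0 hVB G).1
  rw [rotLp_toCell θ h1]
  refine toCell_congr_ae ?_
  filter_upwards [coeFn_rotFieldLp θ G] with x hx
  rw [hx, hVeq, ← (rotZLIE θ).inner_map_map (V x)]
  simp only [rotZLIE_apply, ← rotZ_add, add_neg_cancel, rotZ_zero]

/-- **The weak rotational derivative of an equivariant component of the weak Neumann solution**: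
for smooth periodic data and a smooth equivariant field `V`, bounded on the cell, the scalar
`⟪V, ∇q[h₀,h₁]⟫` has, along the generator `J`, the weak derivative `⟪V, ∇q[∂_J h₀, ∂_J h₁ − J h₁]⟫`
on the open cell. [folklore] -/
theorem hasWeakDerivAlong_rotGen_inner_neumannGrad (hL : 0 < L) {h₀ : ℝ³ → ℝ} {h₁ : ℝ³ → ℝ³}
    (hh₀ : IsSmoothPeriodic L h₀) (hh₁ : IsSmoothPeriodic L h₁) {V : ℝ³ → ℝ³} (hVc : Continuous V)
    (hVeq : ∀ (θ : ℝ) (x : ℝ³), V (rotZ θ x) = rotZ θ (V x)) {B : ℝ} (hB0 : 0 ≤ B)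
    (hVB : ∀ x ∈ (cylinderCell L : Set ℝ³), ‖V x‖ ≤ B) :
    HasWeakDerivAlong (cylinderCell L) volume rotGen
      (fun x => ⟪V x, (((neumannGrad L (toCell L h₀) (toCell L h₁) : gradSpace L) :
        Lp ℝ³ 2 (cellMeasure L)) : ℝ³ → ℝ³) x⟫)
      (fun x => ⟪V x, (((neumannGrad L (toCell L (cylDeriv rotGen h₀))
        (toCell L (fun x => cylDeriv rotGen h₁ x - rotGen (h₁ x))) : gradSpace L) :
          Lp ℝ³ 2 (cellMeasure L)) : ℝ³ → ℝ³) x⟫) := by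
  set G : Lp ℝ³ 2 (cellMeasure L) := ((neumannGrad L (toCell L h₀) (toCell L h₁) : gradSpace L) :
    Lp ℝ³ 2 (cellMeasure L)) with hG
  set GJ : Lp ℝ³ 2 (cellMeasure L) := ((neumannGrad L (toCell L (cylDeriv rotGen h₀))
    (toCell L (fun x => cylDeriv rotGen h₁ x - rotGen (h₁ x))) : gradSpace L) : Lp ℝ³ 2 (cellMeasure L)) with hGJ
  set θ : ℕ → ℝ := fun n => ((n : ℝ) + 1)⁻¹ with hθ_def
  have hθ0 : ∀ n, θ n ≠ 0 := fun n => inv_ne_zero (by positivity)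
  have hθ : Tendsto θ atTop (𝓝 0) := tendsto_one_div_add_atTop_nhds_zero_nat.congr fun n => by
    simp [hθ_def, one_div]
  have hquot := tendsto_rotQuot_coe_neumannGrad hL hh₀ hh₁ hθ0 hθ
  rw [← hG, ← hGJ] at hquot
  -- the scalar classes
  have hf := (norm_toCell_inner_le hVc hB0 hVB G).1
  have hf' := (norm_toCell_inner_le hVc hB0 hVB GJ).1
  have hlim : Tendsto (fun n => (θ n)⁻¹ • (rotLp L (θ n) (toCell L (fun x => ⟪V x, (G : ℝ³ → ℝ³) x⟫)) -
      toCell L (fun x => ⟪V x, (G : ℝ³ → ℝ³) x⟫))) atTop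
      (𝓝 (toCell L (fun x => ⟪V x, (GJ : ℝ³ → ℝ³) x⟫))) := by
    have hpair := tendsto_toCell_inner hVc hB0 hVB hquot
    refine hpair.congr fun n => ?_
    rw [rotLp_toCell_inner_equivariant hVc hVeq hB0 hVB (θ n) G]
    have h1 := (norm_toCell_inner_le hVc hB0 hVB (rotFieldLp L (θ n) G)).1
    rw [← toCell_sub h1 hf, ← toCell_const_smul (f := fun x =>
      ⟪V x, ((rotFieldLp L (θ n) G : Lp ℝ³ 2 (cellMeasure L)) : ℝ³ → ℝ³) x⟫ - ⟪V x, (G : ℝ³ → ℝ³) x⟫)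
      _ (h1.sub hf)]
    refine toCell_congr_ae ?_
    filter_upwards [Lp.coeFn_smul (θ n)⁻¹ (rotFieldLp L (θ n) G - G),
      Lp.coeFn_sub (rotFieldLp L (θ n) G : Lp ℝ³ 2 (cellMeasure L)) G] with x hx1 hx2
    rw [hx1, Pi.smul_apply, hx2, Pi.sub_apply, inner_smul_right, inner_sub_right, smul_eq_mul]
  have hweak := hasWeakDerivAlong_rotGen_of_tendsto _ _ hθ0 hθ hlim
  exact (hweak.congr (coeFn_toCell hf)).congr_deriv (coeFn_toCell hf')

/-- **The weak axial derivative of a component of the weak Neumann solution**: for a smooth field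
`V` not depending on `z` (`DV(x) e_z = 0`), `⟪V, ∇q[h₀,h₁]⟫` has the weak derivative
`⟪V, ∇q[∂_z h₀, ∂_z h₁]⟫` along `e_z` on the open cell. [folklore] -/
theorem hasWeakDerivAlong_eZ_inner_neumannGrad (hL : 0 < L) {h₀ : ℝ³ → ℝ} {h₁ : ℝ³ → ℝ³}
    (hh₀ : IsSmoothPeriodic L h₀) (hh₁ : IsSmoothPeriodic L h₁) {V : ℝ³ → ℝ³} (hV : ContDiff ℝ ∞ V)
    (hVz : ∀ x, fderiv ℝ V x eZ = 0) :
    HasWeakDerivAlong (cylinderCell L) volume (fun _ => eZ)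
      (fun x => ⟪V x, (((neumannGrad L (toCell L h₀) (toCell L h₁) : gradSpace L) :
        Lp ℝ³ 2 (cellMeasure L)) : ℝ³ → ℝ³) x⟫)
      (fun x => ⟪V x, (((neumannGrad L (toCell L (cylDeriv (fun _ => eZ) h₀))
        (toCell L (cylDeriv (fun _ => eZ) h₁)) : gradSpace L) : Lp ℝ³ 2 (cellMeasure L)) : ℝ³ → ℝ³) x⟫) := by
  have h := (hasWeakDerivAlong_eZ_neumannGrad hL hh₀ hh₁).inner_smooth contDiff_const hV
  refine h.congr_deriv (Eventually.of_forall fun x => ?_)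
  simp [hVz x]

end Pairings

/-! ### The economical form of the differentiated data -/

section DataIdentities

/-- **Differentiated data, economical form (axial)**: for smooth periodic data,
`∇q[∂_z h₀, ∂_z h₁] = ∇q[0, ∂_z h₁ − h₀ e_z]` — against a smooth periodic test function,
`∫ (∂_z h₀)(ψ − ⨍ψ) = −∫ h₀ ∂_z ψ` by the periodic integration by parts on the cell. (At the top
order of the regularity count this saves one derivative of `h₀`.) [folklore] -/
theorem neumannGrad_axialData_eq (hL : 0 < L) {h₀ : ℝ³ → ℝ} {h₁ : ℝ³ → ℝ³} (hh₀ : IsSmoothPeriodic L h₀)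
    (hh₁ : IsSmoothPeriodic L h₁) :
    neumannGrad L (toCell L (cylDeriv (fun _ => eZ) h₀)) (toCell L (cylDeriv (fun _ => eZ) h₁)) =
      neumannGrad L 0 (toCell L (fun x => cylDeriv (fun _ => eZ) h₁ x - h₀ x • eZ)) := by
  have hd₀ : IsSmoothPeriodic L (cylDeriv (fun _ => eZ) h₀) :=
    ⟨contDiffOn_cylDeriv contDiff_const hh₀.smooth, hh₀.periodic.cylDeriv fun _ => rfl⟩
  have hd₁ : IsSmoothPeriodic L (cylDeriv (fun _ => eZ) h₁) :=
    ⟨contDiffOn_cylDeriv contDiff_const hh₁.smooth, hh₁.periodic.cylDeriv fun _ => rfl⟩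
  have hrhs : IsSmoothPeriodic L (fun x => cylDeriv (fun _ => eZ) h₁ x - h₀ x • eZ) :=
    hd₁.sub ⟨hh₀.smooth.smul contDiffOn_const, fun x => by simp only [hh₀.periodic x]⟩
  refine eq_neumannGrad_of_forall_inner _ _ fun q hq => ?_
  rw [neumannFunctional_apply, inner_zero_left, zero_add]
  have h := inner_neumannGrad (toCell L (cylDeriv (fun _ => eZ) h₀)) (toCell L (cylDeriv (fun _ => eZ) h₁))
    ⟨toCell L (cylGrad q), gradRange_le_gradSpace (toCell_cylGrad_mem_gradRange hq)⟩
  rw [Submodule.coe_inner, potential_toCell_cylGrad hL hq] at h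
  simp only at h
  rw [h, inner_toCell_toCell hd₀.memLp (hq.sub_const _).memLp, inner_toCell_toCell hd₁.memLp hq.cylGrad.memLp,
    inner_toCell_toCell hrhs.memLp hq.cylGrad.memLp]
  -- `∫ ⟪∂h₁ − h₀ e_z, ∇q⟫ = ∫ ⟪∂h₁, ∇q⟫ − ∫ h₀ ∂_z q`
  have hint₁ : Integrable (fun x => ⟪cylDeriv (fun _ => eZ) h₁ x, cylGrad q x⟫) (cellMeasure L) :=
    integrableOn_cylinderCell_of_continuousOn_K L (hd₁.continuousOn.inner hq.cylGrad.continuousOn)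
  have hint₂ : Integrable (fun x => ⟪h₀ x • (eZ : ℝ³), cylGrad q x⟫) (cellMeasure L) :=
    integrableOn_cylinderCell_of_continuousOn_K L
      ((hh₀.continuousOn.smul continuousOn_const).inner hq.cylGrad.continuousOn)
  have hsplit : ∫ x in (cylinderCell L : Set ℝ³), ⟪cylDeriv (fun _ => eZ) h₁ x - h₀ x • eZ, cylGrad q x⟫ =
      (∫ x in (cylinderCell L : Set ℝ³), ⟪cylDeriv (fun _ => eZ) h₁ x, cylGrad q x⟫) -
        ∫ x in (cylinderCell L : Set ℝ³), h₀ x * cylDeriv (fun _ => eZ) q x := by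
    simp_rw [inner_sub_left]
    rw [integral_sub hint₁ hint₂]
    congr 1
    refine integral_congr_ae (Eventually.of_forall fun x => ?_)
    show ⟪h₀ x • (eZ : ℝ³), cylGrad q x⟫ = h₀ x * cylDeriv (fun _ => eZ) q x
    rw [real_inner_smul_left, inner_cylGrad_right, cylDeriv_apply]
  rw [hsplit]
  -- `∫ (∂_z h₀)(q − c) = −∫ h₀ ∂_z q`
  have hparts := setIntegral_cylDeriv_cylBasis_two_mul hL hh₀.smooth (hq.sub_const (⨍ y in (cylinderCell L : Set ℝ³), q y)).smooth
    hh₀.periodic (hq.sub_const _).periodic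
  rw [cylBasis_two_eq_eZ, cylDeriv_sub_const] at hparts
  have hpt : ∀ x, ⟪cylDeriv (fun _ => eZ) h₀ x, q x - ⨍ y in (cylinderCell L : Set ℝ³), q y⟫ =
      cylDeriv (fun _ => eZ) h₀ x * (q x - ⨍ y in (cylinderCell L : Set ℝ³), q y) := fun x => by
    simp [mul_comm]
  simp_rw [hpt]
  rw [hparts]
  ring

/-- **Differentiated data, economical form (rotational)**:
`∇q[∂_J h₀, ∂_J h₁ − J h₁] = ∇q[0, ∂_J h₁ − J h₁ − h₀ J]`. [folklore] -/
theorem neumannGrad_rotData_eq (hL : 0 < L) {h₀ : ℝ³ → ℝ} {h₁ : ℝ³ → ℝ³} (hh₀ : IsSmoothPeriodic L h₀)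
    (hh₁ : IsSmoothPeriodic L h₁) :
    neumannGrad L (toCell L (cylDeriv rotGen h₀)) (toCell L (fun x => cylDeriv rotGen h₁ x - rotGen (h₁ x))) =
      neumannGrad L 0 (toCell L (fun x => cylDeriv rotGen h₁ x - rotGen (h₁ x) - h₀ x • rotGen x)) := by
  have hd₀ : IsSmoothPeriodic L (cylDeriv rotGen h₀) :=
    ⟨contDiffOn_cylDeriv contDiff_rotGen hh₀.smooth, hh₀.periodic.cylDeriv fun x => rotGen_add_axialShift x L⟩
  have hd₁ : IsSmoothPeriodic L (fun x => cylDeriv rotGen h₁ x - rotGen (h₁ x)) :=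
    (⟨contDiffOn_cylDeriv contDiff_rotGen hh₁.smooth, hh₁.periodic.cylDeriv fun x => rotGen_add_axialShift x L⟩ :
      IsSmoothPeriodic L (cylDeriv rotGen h₁)).sub
      ⟨(rotGenL).contDiff.comp_contDiffOn hh₁.smooth, fun x => by simp only [hh₁.periodic x]⟩
  have hextra : IsSmoothPeriodic L (fun x => h₀ x • rotGen x) :=
    ⟨hh₀.smooth.smul contDiff_rotGen.contDiffOn, fun x => by
      simp only [hh₀.periodic x, rotGen_add_axialShift x L]⟩
  have hrhs : IsSmoothPeriodic L (fun x => cylDeriv rotGen h₁ x - rotGen (h₁ x) - h₀ x • rotGen x) :=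
    hd₁.sub hextra
  refine eq_neumannGrad_of_forall_inner _ _ fun q hq => ?_
  rw [neumannFunctional_apply, inner_zero_left, zero_add]
  have h := inner_neumannGrad (toCell L (cylDeriv rotGen h₀)) (toCell L (fun x => cylDeriv rotGen h₁ x - rotGen (h₁ x)))
    ⟨toCell L (cylGrad q), gradRange_le_gradSpace (toCell_cylGrad_mem_gradRange hq)⟩
  rw [Submodule.coe_inner, potential_toCell_cylGrad hL hq] at h
  simp only at h
  rw [h, inner_toCell_toCell hd₀.memLp (hq.sub_const _).memLp, inner_toCell_toCell hd₁.memLp hq.cylGrad.memLp,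
    inner_toCell_toCell hrhs.memLp hq.cylGrad.memLp]
  have hint₁ : Integrable (fun x => ⟪cylDeriv rotGen h₁ x - rotGen (h₁ x), cylGrad q x⟫) (cellMeasure L) :=
    integrableOn_cylinderCell_of_continuousOn_K L (hd₁.continuousOn.inner hq.cylGrad.continuousOn)
  have hint₂ : Integrable (fun x => ⟪h₀ x • rotGen x, cylGrad q x⟫) (cellMeasure L) :=
    integrableOn_cylinderCell_of_continuousOn_K L (hextra.continuousOn.inner hq.cylGrad.continuousOn)
  have hsplit : ∫ x in (cylinderCell L : Set ℝ³), ⟪cylDeriv rotGen h₁ x - rotGen (h₁ x) - h₀ x • rotGen x, cylGrad q x⟫ =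
      (∫ x in (cylinderCell L : Set ℝ³), ⟪cylDeriv rotGen h₁ x - rotGen (h₁ x), cylGrad q x⟫) -
        ∫ x in (cylinderCell L : Set ℝ³), h₀ x * cylDeriv rotGen q x := by
    have hpt : ∀ x, ⟪cylDeriv rotGen h₁ x - rotGen (h₁ x) - h₀ x • rotGen x, cylGrad q x⟫ =
        ⟪cylDeriv rotGen h₁ x - rotGen (h₁ x), cylGrad q x⟫ - ⟪h₀ x • rotGen x, cylGrad q x⟫ := fun x =>
      inner_sub_left _ _ _
    simp_rw [hpt]
    rw [integral_sub hint₁ hint₂]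
    congr 1
    refine integral_congr_ae (Eventually.of_forall fun x => ?_)
    show ⟪h₀ x • rotGen x, cylGrad q x⟫ = h₀ x * cylDeriv rotGen q x
    rw [real_inner_smul_left, inner_cylGrad_right, cylDeriv_apply]
  rw [hsplit]
  have hparts := setIntegral_cylDeriv_rotGen_mul hL hh₀.smooth (hq.sub_const (⨍ y in (cylinderCell L : Set ℝ³), q y)).smooth
    hh₀.periodic (hq.sub_const _).periodic
  rw [cylDeriv_sub_const] at hparts
  have hpt : ∀ x, ⟪cylDeriv rotGen h₀ x, q x - ⨍ y in (cylinderCell L : Set ℝ³), q y⟫ =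
      cylDeriv rotGen h₀ x * (q x - ⨍ y in (cylinderCell L : Set ℝ³), q y) := fun x => by
    simp [mul_comm]
  simp_rw [hpt]
  rw [hparts]
  ring

end DataIdentities

end PeriodicCylinder

end Literature.Analysis.FluidPDE
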